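import Summits.BirchSwinnertonDyer.Rank1Residual.Iwasawa.SelmerCardOfLevelZeroControlLambda
import Summits.BirchSwinnertonDyer.Rank1Residual.Additive.GordCycLowerBoundOfControl
import Summits.BirchSwinnertonDyer.Rank1Residual.Additive.X4RankZeroCoveredLocusManinFree
import Summits.BirchSwinnertonDyer.Rank1Residual.AdditivePotMult.LocalTowerKernelAtPPotMult
import Summits.BirchSwinnertonDyer.Rank1Residual.AdditivePotMult.RankZeroChiBranchPrimeFacts
import Literature.NumberTheory.EllipticCurves.BSDShaProofs
import HarnessLib

/-!
# `p ∣ #Ш(E/ℚ)` from a non-trivial characteristic ideal by control, and the LOWER half WITHOUT ANY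
# typed input on the rank-`0` rows with `λ ≠ 0` (or `μ ≠ 0`) and `ord_p #Ш_an ≤ 2`, via Cassels–Tate
# (team n1011, row T-CTL-EC, seat p06 GEN 9, FILE 4 — the census-facing END of the row)

HONEST FRAMING (cell `b2b-bsdres-*`, team n1011, verbatim): prove what is provable now; shrink each
hard class to its core with data; no claim beyond stated classes. Research route on
CONSTRUCTION-SHAPED X4 / §I N10–N11; TOOL + CONSUMER theorems only — no definition, no named fact,
nothing booked, no residual-map mark moved, no class closed by this file alone: every END below
carries a `λ ≠ 0` / `char ≠ Λ` hypothesis on the cyclotomic dual datum, to be fed per row (e.g. by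
the cell's Greenberg–Vatsal transfer ENDs from a trivial congruent partner) — that feed is the
consumers', not this file's.

## What

FILE 1 / FILE 1b (`Iwasawa/SelmerCardOfLevelZeroControl[Lambda]`): trivial level-`0` local tower
kernels + `E(K)[p] = 0` + `Sel_{p^∞}(E/K)` finite ⟹ `f(0) ∣ #Sel_{p^∞}(E/K)`, hence
`char ≠ Λ` / `λ ≠ 0` / `μ ≠ 0` ⟹ `p ∣ #Sel_{p^∞}(E/K)`. Over `ℚ` in analytic rank `0`
(`hGZK`: `E(ℚ)` finite, `Ш` finite; `#Sel_{p^∞} = #Ш[p^∞]`, `#Ш[p^∞] ∣ #Ш`):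

* `dvd_card_sha_rankZero_of_charIdeal_ne_top[_of_lambda_ne_zero|_of_mu_ne_zero]` — **`p ∣ #Ш(E/ℚ)`**;
* `sq_dvd_card_sha_rankZero_of_charIdeal_ne_top_of_casselsTate` — with the PUBLISHED Cassels–Tate
  pairing (`exists_casselsTate_pairing`, Silverman AEC X.4.14; tree consequence
  `isSquare_card_sha_of_finite_of_casselsTate`): **`p² ∣ #Ш(E/ℚ)`**;
* `missingLowerBoundAt_rankZero_of_charIdeal_ne_top_of_casselsTate` — if moreover `#Ш_an(E) = s` with
  `ord_p s ≤ 2` (census: `#Ш_an = p²·unit` or a `p`-unit), then **`Typed.MissingLowerBoundAt W p`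
  (`ord_p #Ш_an ≤ ord_p #Ш`) with NO typed input at all** — neither `CycLowerBoundAt` nor any main
  conjecture half; inputs = Cassels–Tate + GZK + the sockets + `p ∤ #tors` + `λ/μ/char` of the dual datum;
* class ENDs `ClassX4Gord.missingLowerBoundAt_rankZero_of_lambda_ne_zero_of_casselsTate` (`p ≥ 5`,
  additive-or-numeric bad places) / `…_allNumeric` (every odd `p`), `ClassX4M.…_allNumeric (hT41)`;
* CAPSTONES `ClassX4Gord.bsdp_rankZero_of_lambda_ne_zero_of_casselsTate_maninFree` (`p ≥ 5`, `ρ̄` onto,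
  `p ∤ ∏ c_ℓ`; upper half = additive-p4's `X4RankZero.missingUpperBoundAt_of_facts_of_five_le_maninFree`)
  and `ClassX4M.bsdp_rankZero_of_lambda_ne_zero_of_casselsTate` (every odd `p`, `ρ̄` onto; upper half =
  `AdditivePotMult.ClassX4M.missingUpperBoundAt_rankZero_of_surj`): **`BSD(E,p)` from PRINTED facts +
  census data + `λ(X(E/ℚ_∞)) ≠ 0`**, on rank-`0` rows with `ord_p #Ш_an ≤ 2`.

Why this matters (RESIDUAL-MAP §I N10 / N11 wording, no mark moved): the rank-`0` X4 rows left open by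
the `p ∤ #Ш_an` chain of record are exactly the `p ∣ #Ш_an` rows, where the LOWER half is the missing
input; on those with `#Ш_an = p² · unit` this file reduces the lower half to ONE Iwasawa-side bit,
`λ ≠ 0 ∨ μ ≠ 0` for the cyclotomic dual datum — a bit the Greenberg–Vatsal transfer computes from a
trivial congruent partner and the local `δ`-invariants. Rank `1` and `ord_p #Ш_an ≥ 4` are NOT covered.

References: [GreenbergLNM1716] §3 Prop. 3.8, §4 Thm. 4.1; [SilvermanAEC2009] Thm. X.4.14
(Cassels–Tate); [Cassels1962ArithmeticIV]; [Miller2011LMS] Def. 1.1; [Kato2004Asterisque] Thm. 14.5 (3);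
[Delbourgo1998] Prop. 4; [SilvermanATAEC1994] V.5.3/5.4; cells/n1011/skel/T-CTL-EC.md.
-/

noncomputable section

open scoped Classical NumberField

open WeierstrassCurve NumberField Literature.NumberTheory.EllipticCurves
  Literature.NumberTheory.EllipticCurves.ModularForms
  Literature.NumberTheory.EllipticCurves.Rank1Residual
  Literature.NumberTheory.EllipticCurves.Rank1Residual.Typed
  IsDedekindDomain Rat.HeightOneSpectrum Summit.BirchSwinnertonDyer.Rank1Residual.Iwasawa

namespace Summit.BirchSwinnertonDyer.Rank1Residual.Additive

variable (W : WeierstrassCurve ℚ) [W.IsElliptic] (p : ℕ) [hp : Fact p.Prime]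

/-! ### §1 `p ∣ #Ш(E/ℚ)` in rank `0` from a non-trivial characteristic ideal -/

/-- **`char_Λ X(E/ℚ_∞) ≠ Λ ⟹ p ∣ #Ш(E/ℚ)` in analytic rank `0`** (GZK: `E(ℚ)`, `Ш` finite; `p ∤ #tors`;
every level-`0` local tower kernel of the `ℤ_p`-extension `κ` trivial): FILE 1's
`dvd_natCard_selmer_of_charIdeal_ne_top_of_no_pTorsion` gives `p ∣ #Sel_{p^∞}(E/ℚ) = #Ш[p^∞]`, and
`#Ш[p^∞] ∣ #Ш` (Lagrange). [cite: GreenbergLNM1716, §3 Prop. 3.8 (pp. 95–96) and §4 Thm. 4.1 (pp. 102–104)] -/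
theorem dvd_card_sha_rankZero_of_charIdeal_ne_top
    (hGZK : rank_eq_analyticRank_of_analyticRank_le_one) (hr : W.analyticRank = 0)
    (htors : ¬ p ∣ W.torsionOrder) {κ : ZpExtension ℚ p} {γ : Field.absoluteGaloisGroup ℚ}
    (D : W.SelmerDualData κ γ) (hγ : κ.IsTopGenerator γ) (hD : D.charIdeal ≠ ⊤)
    (h0 : ∀ v : HeightOneSpectrum (𝓞 ℚ), W.localTowerKerPrimary κ (v.adicCompletion ℚ) 0 = ⊥) :
    p ∣ Nat.card W.sha := by
  obtain ⟨hrk, hfin⟩ := hGZK W (by omega)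
  have hrank : W.mordellWeilRank = 0 := by rw [hrk, hr]
  haveI : Finite W.toAffine.Point := W.mordellWeilRank_eq_zero_iff_finite.mp hrank
  haveI : Finite W.sha := hfin
  haveI : Finite (AddCommGroup.primaryComponent W.sha p) := inferInstance
  have hSel : Finite (W.selmerGroupPInfty p) := W.finite_selmerGroupPInfty_of_finite_primaryComponent p
  have hK := forall_smul_eq_zero_imp_of_not_dvd_torsionOrder W (p := p) htors
  have h1 : p ∣ Nat.card ↥(W.selmerGroupPInfty p) :=
    dvd_natCard_selmer_of_charIdeal_ne_top_of_no_pTorsion W D hγ hSel hK hD h0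
  rw [W.card_selmerGroupPInfty_eq_card_primaryComponent_sha p] at h1
  exact h1.trans (AddSubgroup.card_addSubgroup_dvd_card (AddCommGroup.primaryComponent W.sha p))

/-- **`λ(X(E/ℚ_∞)) ≠ 0 ⟹ p ∣ #Ш(E/ℚ)`** in analytic rank `0` (FILE 1b's
`not_isUnit_of_lambdaInvariant_ne_zero_of_charIdeal_eq_span`). [cite: GreenbergLNM1716, §4 Thm. 4.1 (pp. 102–104)] [cite: Washington1997, §13.2] -/
theorem dvd_card_sha_rankZero_of_lambda_ne_zero
    (hGZK : rank_eq_analyticRank_of_analyticRank_le_one) (hr : W.analyticRank = 0)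
    (htors : ¬ p ∣ W.torsionOrder) {κ : ZpExtension ℚ p} {γ : Field.absoluteGaloisGroup ℚ}
    (D : W.SelmerDualData κ γ) (hγ : κ.IsTopGenerator γ) (hlam : D.lambda ≠ 0)
    (h0 : ∀ v : HeightOneSpectrum (𝓞 ℚ), W.localTowerKerPrimary κ (v.adicCompletion ℚ) 0 = ⊥) :
    p ∣ Nat.card W.sha := by
  obtain ⟨hrk, hfin⟩ := hGZK W (by omega)
  have hrank : W.mordellWeilRank = 0 := by rw [hrk, hr]
  haveI : Finite W.toAffine.Point := W.mordellWeilRank_eq_zero_iff_finite.mp hrank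
  haveI : Finite W.sha := hfin
  haveI : Finite (AddCommGroup.primaryComponent W.sha p) := inferInstance
  have hSel : Finite (W.selmerGroupPInfty p) := W.finite_selmerGroupPInfty_of_finite_primaryComponent p
  have hK := forall_smul_eq_zero_imp_of_not_dvd_torsionOrder W (p := p) htors
  have h1 : p ∣ Nat.card ↥(W.selmerGroupPInfty p) :=
    dvd_natCard_selmer_of_lambda_ne_zero_of_no_pTorsion W D hγ hSel hK hlam h0
  rw [W.card_selmerGroupPInfty_eq_card_primaryComponent_sha p] at h1
  exact h1.trans (AddSubgroup.card_addSubgroup_dvd_card (AddCommGroup.primaryComponent W.sha p))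

/-- **`μ(X(E/ℚ_∞)) ≠ 0 ⟹ p ∣ #Ш(E/ℚ)`** in analytic rank `0` (FILE 1's
`dvd_natCard_selmer_of_mu_ne_zero_of_no_pTorsion`). [cite: GreenbergLNM1716, §4 Thm. 4.1 (pp. 102–104)] [cite: GreenbergVatsal2000, p. 2, (1)–(2)] -/
theorem dvd_card_sha_rankZero_of_mu_ne_zero
    (hGZK : rank_eq_analyticRank_of_analyticRank_le_one) (hr : W.analyticRank = 0)
    (htors : ¬ p ∣ W.torsionOrder) {κ : ZpExtension ℚ p} {γ : Field.absoluteGaloisGroup ℚ}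
    (D : W.SelmerDualData κ γ) (hγ : κ.IsTopGenerator γ) (hμ : D.mu ≠ 0)
    (h0 : ∀ v : HeightOneSpectrum (𝓞 ℚ), W.localTowerKerPrimary κ (v.adicCompletion ℚ) 0 = ⊥) :
    p ∣ Nat.card W.sha := by
  obtain ⟨hrk, hfin⟩ := hGZK W (by omega)
  have hrank : W.mordellWeilRank = 0 := by rw [hrk, hr]
  haveI : Finite W.toAffine.Point := W.mordellWeilRank_eq_zero_iff_finite.mp hrank
  haveI : Finite W.sha := hfin
  haveI : Finite (AddCommGroup.primaryComponent W.sha p) := inferInstance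
  have hSel : Finite (W.selmerGroupPInfty p) := W.finite_selmerGroupPInfty_of_finite_primaryComponent p
  have hK := forall_smul_eq_zero_imp_of_not_dvd_torsionOrder W (p := p) htors
  have h1 : p ∣ Nat.card ↥(W.selmerGroupPInfty p) :=
    dvd_natCard_selmer_of_mu_ne_zero_of_no_pTorsion W D hγ hSel hK hμ h0
  rw [W.card_selmerGroupPInfty_eq_card_primaryComponent_sha p] at h1
  exact h1.trans (AddSubgroup.card_addSubgroup_dvd_card (AddCommGroup.primaryComponent W.sha p))

/-! ### §2 Cassels–Tate: `p ∣ #Ш ⟹ p² ∣ #Ш`, and the LOWER half with no typed input -/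

/-- A prime dividing a square divides it twice. [folklore] -/
private theorem sq_dvd_of_prime_dvd_of_isSquare {n : ℕ} (hsq : IsSquare n) (h : p ∣ n) :
    p ^ 2 ∣ n := by
  obtain ⟨r, rfl⟩ := hsq
  have hr : p ∣ r := by
    rcases (Nat.Prime.dvd_mul hp.out).mp h with h | h <;> exact h
  rw [sq]
  exact mul_dvd_mul hr hr

/-- **`λ(X) ≠ 0 ⟹ p² ∣ #Ш(E/ℚ)`** in analytic rank `0`, granted the PUBLISHED Cassels–Tate pairing
(`hCT : exists_casselsTate_pairing`, Silverman AEC Thm. X.4.14: `#Ш` finite ⟹ square).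
[cite: SilvermanAEC2009, Thm. X.4.14] [cite: GreenbergLNM1716, §4 Thm. 4.1 (pp. 102–104)] -/
theorem sq_dvd_card_sha_rankZero_of_lambda_ne_zero_of_casselsTate
    (hCT : exists_casselsTate_pairing (K := ℚ))
    (hGZK : rank_eq_analyticRank_of_analyticRank_le_one) (hr : W.analyticRank = 0)
    (htors : ¬ p ∣ W.torsionOrder) {κ : ZpExtension ℚ p} {γ : Field.absoluteGaloisGroup ℚ}
    (D : W.SelmerDualData κ γ) (hγ : κ.IsTopGenerator γ) (hlam : D.lambda ≠ 0)
    (h0 : ∀ v : HeightOneSpectrum (𝓞 ℚ), W.localTowerKerPrimary κ (v.adicCompletion ℚ) 0 = ⊥) :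
    p ^ 2 ∣ Nat.card W.sha := by
  obtain ⟨-, hfin⟩ := hGZK W (by omega)
  haveI : Finite W.sha := hfin
  exact sq_dvd_of_prime_dvd_of_isSquare p (W.isSquare_card_sha_of_finite_of_casselsTate hCT)
    (dvd_card_sha_rankZero_of_lambda_ne_zero W p hGZK hr htors D hγ hlam h0)

/-- **`char ≠ Λ ⟹ p² ∣ #Ш(E/ℚ)`** in analytic rank `0`, granted Cassels–Tate.
[cite: SilvermanAEC2009, Thm. X.4.14] [cite: GreenbergLNM1716, §4 Thm. 4.1 (pp. 102–104)] -/
theorem sq_dvd_card_sha_rankZero_of_charIdeal_ne_top_of_casselsTate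
    (hCT : exists_casselsTate_pairing (K := ℚ))
    (hGZK : rank_eq_analyticRank_of_analyticRank_le_one) (hr : W.analyticRank = 0)
    (htors : ¬ p ∣ W.torsionOrder) {κ : ZpExtension ℚ p} {γ : Field.absoluteGaloisGroup ℚ}
    (D : W.SelmerDualData κ γ) (hγ : κ.IsTopGenerator γ) (hD : D.charIdeal ≠ ⊤)
    (h0 : ∀ v : HeightOneSpectrum (𝓞 ℚ), W.localTowerKerPrimary κ (v.adicCompletion ℚ) 0 = ⊥) :
    p ^ 2 ∣ Nat.card W.sha := by
  obtain ⟨-, hfin⟩ := hGZK W (by omega)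
  haveI : Finite W.sha := hfin
  exact sq_dvd_of_prime_dvd_of_isSquare p (W.isSquare_card_sha_of_finite_of_casselsTate hCT)
    (dvd_card_sha_rankZero_of_charIdeal_ne_top W p hGZK hr htors D hγ hD h0)

/-- **THE LOWER HALF WITH NO TYPED INPUT: `λ(X(E/ℚ_∞)) ≠ 0` ∧ `ord_p #Ш_an(E) ≤ 2` ⟹
`Typed.MissingLowerBoundAt W p`** (analytic rank `0`; GZK; Cassels–Tate; `p ∤ #E(ℚ)_tors`; every
level-`0` local tower kernel of `κ` trivial). From `p² ∣ #Ш` and `#Ш ≠ 0`: `2 ≤ ord_p #Ш`, and the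
census datum `ord_p s ≤ 2` for `#Ш_an = s` closes the inequality. Neither `CycLowerBoundAt` nor any
main-conjecture half enters. [cite: SilvermanAEC2009, Thm. X.4.14] [cite: Miller2011LMS, Def. 1.1]
[cite: GreenbergLNM1716, §3 Prop. 3.8 (pp. 95–96) and §4 Thm. 4.1 (pp. 102–104)] -/
theorem missingLowerBoundAt_rankZero_of_lambda_ne_zero_of_casselsTate
    (hCT : exists_casselsTate_pairing (K := ℚ))
    (hGZK : rank_eq_analyticRank_of_analyticRank_le_one) (hr : W.analyticRank = 0)
    (htors : ¬ p ∣ W.torsionOrder) {κ : ZpExtension ℚ p} {γ : Field.absoluteGaloisGroup ℚ}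
    (D : W.SelmerDualData κ γ) (hγ : κ.IsTopGenerator γ) (hlam : D.lambda ≠ 0)
    (h0 : ∀ v : HeightOneSpectrum (𝓞 ℚ), W.localTowerKerPrimary κ (v.adicCompletion ℚ) 0 = ⊥)
    (hsha : ∃ s : ℚ, shaAn W = (s : ℂ) ∧ padicValRat p s ≤ 2) :
    MissingLowerBoundAt W p := by
  obtain ⟨s, hs, hle⟩ := hsha
  obtain ⟨-, hfin⟩ := hGZK W (by omega)
  haveI : Finite W.sha := hfin
  have hsq := sq_dvd_card_sha_rankZero_of_lambda_ne_zero_of_casselsTate W p hCT hGZK hr htors D hγ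
    hlam h0
  have hne : W.shaOrder ≠ 0 := by
    rw [WeierstrassCurve.shaOrder]; exact Nat.card_pos.ne'
  have h2 : 2 ≤ padicValNat p W.shaOrder := (padicValNat_dvd_iff_le hne).mp hsq
  refine ⟨s, hs, hle.trans ?_⟩
  exact_mod_cast h2

/-- The same with `char_Λ X ≠ Λ` in place of `λ ≠ 0` (so `μ ≠ 0` also qualifies).
[cite: SilvermanAEC2009, Thm. X.4.14] [cite: Miller2011LMS, Def. 1.1] [cite: GreenbergLNM1716, §4 Thm. 4.1 (pp. 102–104)] -/
theorem missingLowerBoundAt_rankZero_of_charIdeal_ne_top_of_casselsTate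
    (hCT : exists_casselsTate_pairing (K := ℚ))
    (hGZK : rank_eq_analyticRank_of_analyticRank_le_one) (hr : W.analyticRank = 0)
    (htors : ¬ p ∣ W.torsionOrder) {κ : ZpExtension ℚ p} {γ : Field.absoluteGaloisGroup ℚ}
    (D : W.SelmerDualData κ γ) (hγ : κ.IsTopGenerator γ) (hD : D.charIdeal ≠ ⊤)
    (h0 : ∀ v : HeightOneSpectrum (𝓞 ℚ), W.localTowerKerPrimary κ (v.adicCompletion ℚ) 0 = ⊥)
    (hsha : ∃ s : ℚ, shaAn W = (s : ℂ) ∧ padicValRat p s ≤ 2) :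
    MissingLowerBoundAt W p := by
  obtain ⟨s, hs, hle⟩ := hsha
  obtain ⟨-, hfin⟩ := hGZK W (by omega)
  haveI : Finite W.sha := hfin
  have hsq := sq_dvd_card_sha_rankZero_of_charIdeal_ne_top_of_casselsTate W p hCT hGZK hr htors D hγ
    hD h0
  have hne : W.shaOrder ≠ 0 := by
    rw [WeierstrassCurve.shaOrder]; exact Nat.card_pos.ne'
  have h2 : 2 ≤ padicValNat p W.shaOrder := (padicValNat_dvd_iff_le hne).mp hsq
  refine ⟨s, hs, hle.trans ?_⟩
  exact_mod_cast h2

/-! ### §3 CLASS ENDS (sockets discharged by name) and CAPSTONES -/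

variable {W p} in
/-- **X4♯(G-ord), `r_an = 0`, EVERY odd `p`, all bad places away from `p` by the numeric test: the LOWER
half from `λ(X(E/ℚ_∞)) ≠ 0` (for the dual datum `D` over ANY `ℤ_p`-extension `κ` with topological
generator `γ`) and `ord_p #Ш_an ≤ 2`, granted Cassels–Tate and GZK — NO typed input.** The `v = p`
socket is T-T3B F7, `p ∤ #tors` is `Irr`. X4 is NOT closed as a class (the `λ ≠ 0` bit is per row);
nothing booked. [cite: SilvermanAEC2009, Thm. X.4.14] [cite: Miller2011LMS, Def. 1.1]
[cite: GreenbergLNM1716, §3 Prop. 3.8 (pp. 95–96), Lemma 3.4 (p. 89) and §4 Thm. 4.1 (pp. 102–104)] -/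
theorem ClassX4Gord.missingLowerBoundAt_rankZero_of_lambda_ne_zero_of_casselsTate [W.IsGloballyMinimal]
    (hCT : exists_casselsTate_pairing (K := ℚ)) (hX : ClassX4Gord W p)
    (hGZK : rank_eq_analyticRank_of_analyticRank_le_one) (hr : W.analyticRank = 0)
    {κ : ZpExtension ℚ p} {γ : Field.absoluteGaloisGroup ℚ} (D : W.SelmerDualData κ γ)
    (hγ : κ.IsTopGenerator γ) (hlam : D.lambda ≠ 0) (S : Finset (HeightOneSpectrum (𝓞 ℚ)))
    (hS : ∀ v ∈ S, (p : 𝓞 ℚ) ∉ v.asIdeal →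
      (primesEquiv v : ℕ) ≠ p ∧ ¬ p ∣ (W.baseChange (v.adicCompletion ℚ)).localTamagawaNumber
        (v.adicCompletionIntegers ℚ) * reductionPointCount W (primesEquiv v : ℕ))
    (hgood : ∀ v ∉ S, (p : 𝓞 ℚ) ∉ v.asIdeal ∧ W.HasGoodReductionAt v)
    (hsha : ∃ s : ℚ, shaAn W = (s : ℂ) ∧ padicValRat p s ≤ 2) :
    MissingLowerBoundAt W p := by
  refine Additive.missingLowerBoundAt_rankZero_of_lambda_ne_zero_of_casselsTate W p hCT hGZK hr
    (Supersingular.not_dvd_torsionOrder_of_irr W p hX.1.2.2) D hγ hlam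
    (localTowerKerPrimary_zero_eq_bot_of_finset W κ S (fun v hv ↦ ?_) hgood) hsha
  by_cases hpv : (p : 𝓞 ℚ) ∈ v.asIdeal
  · exact GoodModelLine.ClassX4Gord.localTowerKerPrimary_zero_eq_bot hX hpv κ
  · obtain ⟨hne, hnum⟩ := hS v hv hpv
    haveI : Fact (Nat.Prime (primesEquiv v : ℕ)) := ⟨(primesEquiv v).2⟩
    exact localTowerKerPrimary_zero_eq_bot_of_not_dvd W κ v (primesEquiv v : ℕ) rfl hne hpv hnum

variable {W p} in
/-- **X4(M), `r_an = 0`, EVERY odd `p`, all bad places away from `p` numeric: the LOWER half from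
`λ ≠ 0` and `ord_p #Ш_an ≤ 2`, granted Cassels–Tate, GZK and the Tate uniformisation A41 (`hT41`, the
`v ∋ p` socket of T-T3M) — NO typed input.** Nothing booked. [cite: SilvermanAEC2009, Thm. X.4.14]
[cite: SilvermanATAEC1994, Ch. V Thm. 5.3, Cor. 5.4] [cite: Miller2011LMS, Def. 1.1]
[cite: GreenbergLNM1716, §3 Prop. 3.8 (pp. 95–96) and §4 Thm. 4.1 (pp. 102–104)] -/
theorem ClassX4M.missingLowerBoundAt_rankZero_of_lambda_ne_zero_of_casselsTate [W.IsGloballyMinimal]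
    (hCT : exists_casselsTate_pairing (K := ℚ))
    (hT41 : Silverman1994_thmV53_corV54_tateUniformisation.{0}) (hX : AdditivePotMult.ClassX4M W p)
    (hGZK : rank_eq_analyticRank_of_analyticRank_le_one) (hr : W.analyticRank = 0)
    {κ : ZpExtension ℚ p} {γ : Field.absoluteGaloisGroup ℚ} (D : W.SelmerDualData κ γ)
    (hγ : κ.IsTopGenerator γ) (hlam : D.lambda ≠ 0) (S : Finset (HeightOneSpectrum (𝓞 ℚ)))
    (hS : ∀ v ∈ S, (p : 𝓞 ℚ) ∉ v.asIdeal →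
      (primesEquiv v : ℕ) ≠ p ∧ ¬ p ∣ (W.baseChange (v.adicCompletion ℚ)).localTamagawaNumber
        (v.adicCompletionIntegers ℚ) * reductionPointCount W (primesEquiv v : ℕ))
    (hgood : ∀ v ∉ S, (p : 𝓞 ℚ) ∉ v.asIdeal ∧ W.HasGoodReductionAt v)
    (hsha : ∃ s : ℚ, shaAn W = (s : ℂ) ∧ padicValRat p s ≤ 2) :
    MissingLowerBoundAt W p := by
  refine Additive.missingLowerBoundAt_rankZero_of_lambda_ne_zero_of_casselsTate W p hCT hGZK hr
    (Supersingular.not_dvd_torsionOrder_of_irr W p hX.irr) D hγ hlam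
    (localTowerKerPrimary_zero_eq_bot_of_finset W κ S (fun v hv ↦ ?_) hgood) hsha
  by_cases hpv : (p : 𝓞 ℚ) ∈ v.asIdeal
  · exact AdditivePotMult.ClassX4M.localTowerKerPrimary_zero_eq_bot hT41 hX hpv κ
  · obtain ⟨hne, hnum⟩ := hS v hv hpv
    haveI : Fact (Nat.Prime (primesEquiv v : ℕ)) := ⟨(primesEquiv v).2⟩
    exact localTowerKerPrimary_zero_eq_bot_of_not_dvd W κ v (primesEquiv v : ℕ) rfl hne hpv hnum

variable {W p} in
/-- **CAPSTONE X4♯(G-ord), `r_an = 0`, `ρ̄` onto, `p ≥ 5`, `p ∤ ∏ c_ℓ`, `ord_p #Ш_an ≤ 2`, `λ ≠ 0`: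
`BSD(E,p)` from PRINTED facts (Cassels–Tate, Kato 14.5 (3) Manin-free reading `hKatoMF`, Delbourgo 1998
Prop. 4 `hDel98`, GZK, modularity, Wuthrich–Kato component `hKatoχ`) + census data + the Iwasawa bit
`λ(X(E/ℚ_∞)) ≠ 0` — NO typed input.** Upper half = additive-p4's
`X4RankZero.missingUpperBoundAt_of_facts_of_five_le_maninFree`. X4 stays CONSTRUCTION-SHAPED as a class;
nothing booked. [cite: Kato2004Asterisque, Thm. 14.5 (3) (p. 236)] [cite: Delbourgo1998, Prop. 4 (p. 144)]
[cite: SilvermanAEC2009, Thm. X.4.14] [cite: Miller2011LMS, Def. 1.1] -/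
theorem ClassX4Gord.bsdp_rankZero_of_lambda_ne_zero_of_casselsTate_maninFree [W.IsGloballyMinimal]
    (hCT : exists_casselsTate_pairing (K := ℚ))
    (hKatoMF : Kato2004.rankZero_padicValNat_sha_le_sub_localTamagawa_of_additive_potGood_of_imageContainsSL2_maninFree)
    (hDel98 : Delbourgo1998.prop4_rankZero_pow_dvd_constantCoeff)
    (hGZK : rank_eq_analyticRank_of_analyticRank_le_one) (hmod : hasEntireLFunction_rat)
    (hmodD : nonempty_modularParametrizationData)
    (hKatoχ : Wuthrich2014.kato_halfEigenCharIdeal_dvd_cyclotomicPrime_of_surjective)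
    (hX : ClassX4Gord W p) (hp5 : 5 ≤ p) (hr : W.analyticRank = 0) (hsurj : Surj W p)
    (htam : ¬ p ∣ W.tamagawaProduct)
    {κ : ZpExtension ℚ p} {γ : Field.absoluteGaloisGroup ℚ} (D : W.SelmerDualData κ γ)
    (hγ : κ.IsTopGenerator γ) (hlam : D.lambda ≠ 0) (S : Finset (HeightOneSpectrum (𝓞 ℚ)))
    (hS : ∀ v ∈ S, (p : 𝓞 ℚ) ∉ v.asIdeal →
      (primesEquiv v : ℕ) ≠ p ∧ ¬ p ∣ (W.baseChange (v.adicCompletion ℚ)).localTamagawaNumber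
        (v.adicCompletionIntegers ℚ) * reductionPointCount W (primesEquiv v : ℕ))
    (hgood : ∀ v ∉ S, (p : 𝓞 ℚ) ∉ v.asIdeal ∧ W.HasGoodReductionAt v)
    (hsha : ∃ s : ℚ, shaAn W = (s : ℂ) ∧ padicValRat p s ≤ 2) : BSDp W p :=
  bsdp_of_missingPPartAt W p hGZK (by rw [hr]; exact zero_le_one)
    (missingPPartAt_of_lower_of_upper W p
      (ClassX4Gord.missingLowerBoundAt_rankZero_of_lambda_ne_zero_of_casselsTate hCT hX hGZK hr D hγ hlam
        S hS hgood hsha)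
      (X4RankZero.missingUpperBoundAt_of_facts_of_five_le_maninFree W p hKatoMF hDel98 hGZK hmod hmodD
        hKatoχ hp5 hr hX.1 hsurj (Or.inr htam)))

variable {W p} in
/-- **CAPSTONE X4(M), `r_an = 0`, `ρ̄` onto, EVERY odd `p`, `ord_p #Ш_an ≤ 2`, `λ ≠ 0`: `BSD(E,p)` from
PRINTED facts (Cassels–Tate, Tate A41, Delbourgo 1998 Prop. 4, GZK, modularity, Wuthrich Lemma 20,
Kato component) + census data + `λ(X(E/ℚ_∞)) ≠ 0` — NO typed input.** Upper half =
`AdditivePotMult.ClassX4M.missingUpperBoundAt_rankZero_of_surj`. Nothing booked.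
[cite: Delbourgo1998, Prop. 4 (p. 144)] [cite: SilvermanATAEC1994, Ch. V Thm. 5.3, Cor. 5.4]
[cite: SilvermanAEC2009, Thm. X.4.14] [cite: Miller2011LMS, Def. 1.1] -/
theorem ClassX4M.bsdp_rankZero_of_lambda_ne_zero_of_casselsTate [W.IsGloballyMinimal]
    (hCT : exists_casselsTate_pairing (K := ℚ))
    (hT41 : Silverman1994_thmV53_corV54_tateUniformisation.{0})
    (hDel98 : Delbourgo1998.prop4_rankZero_pow_dvd_constantCoeff)
    (hGZK : rank_eq_analyticRank_of_analyticRank_le_one) (hmod : hasEntireLFunction_rat)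
    (hmodD : nonempty_modularParametrizationData)
    (hL20 : Wuthrich2014.lemma20_surjective_threeAdic_of_semistable)
    (hKato : Wuthrich2014.kato_halfEigenCharIdeal_dvd_cyclotomicPrime_of_surjective)
    (hX : AdditivePotMult.ClassX4M W p) (hr : W.analyticRank = 0) (hsurj : Surj W p)
    {κ : ZpExtension ℚ p} {γ : Field.absoluteGaloisGroup ℚ} (D : W.SelmerDualData κ γ)
    (hγ : κ.IsTopGenerator γ) (hlam : D.lambda ≠ 0) (S : Finset (HeightOneSpectrum (𝓞 ℚ)))
    (hS : ∀ v ∈ S, (p : 𝓞 ℚ) ∉ v.asIdeal →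
      (primesEquiv v : ℕ) ≠ p ∧ ¬ p ∣ (W.baseChange (v.adicCompletion ℚ)).localTamagawaNumber
        (v.adicCompletionIntegers ℚ) * reductionPointCount W (primesEquiv v : ℕ))
    (hgood : ∀ v ∉ S, (p : 𝓞 ℚ) ∉ v.asIdeal ∧ W.HasGoodReductionAt v)
    (hsha : ∃ s : ℚ, shaAn W = (s : ℂ) ∧ padicValRat p s ≤ 2) : BSDp W p :=
  bsdp_of_missingPPartAt W p hGZK (by rw [hr]; exact zero_le_one)
    (missingPPartAt_of_lower_of_upper W p
      (ClassX4M.missingLowerBoundAt_rankZero_of_lambda_ne_zero_of_casselsTate hCT hT41 hX hGZK hr D hγ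
        hlam S hS hgood hsha)
      (AdditivePotMult.ClassX4M.missingUpperBoundAt_rankZero_of_surj hDel98 hGZK hmod hmodD hL20 hKato hX
        hr hsurj))

end Summit.BirchSwinnertonDyer.Rank1Residual.Additive

end
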